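import Summits.ResolutionOfSingularities.ResolutionOfSingularities.Theorems.WeightedInvariantWeightedThesisHypersurfaceChoiceDim
import Summits.ResolutionOfSingularities.ResolutionOfSingularities.Theorems.WeightedInvariantWeightedThesisHypersurfaceChoiceTower
import HarnessLib

/-!
# Crux `WeightedThesis` (stmt-ResolutionOfSingularities-0569): choices in EVERY TRANSVERSAL DIMENSION suffice

Topic: `Summits/ResolutionOfSingularities/ResolutionOfSingularities/Theorems`. Route
`ResolutionOfSingularities/WeightedInvariant`, crux `Theses.WeightedInvariant.WeightedThesis`, line
`datum-glued-split`, lead c9, RESHAPE 9 — the tower and the composition for the LADDER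
`HypersurfaceCentreChoiceDim p e` (`Theorems/…HypersurfaceChoiceDim.lean`: the four obligations of a choice
demanded only on the pairs reached, along the towers of the centre rule, from a start pair whose
hypersurface has dimension `e`).

* `HypersurfaceChoiceDimTower.hasResolution_quotient_of_gradedAtlas` — the tower INSIDE one reachability
  class: well-founded induction on `ReachDim e P ∧ Step P' P` (property `(T)`), motive guarded by
  `ReachDim e P`, the successor being reached by `ReachDim.step`; otherwise verbatim the choice tower
  (`HypersurfaceChoiceTower.hasResolution_quotient_of_gradedAtlas`);
* `HypersurfaceChoiceDimTower.hasResolution_hypersurface_of_choiceDim_field` — choices in every transversal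
  dimension at `p = char k` and Bergh–Rydh over `k` resolve every integral hypersurface `i : X ⟶ Y` of a
  smooth separated quasi-compact `k`-scheme (start the tower in dimension `e = dim V(ker i)`,
  `hyp_exists_nat_topologicalKrullDim_ker_subscheme`);
* `HypersurfaceChoiceDimTower.hasResolution_of_choiceDim_field`,
  `HypersurfaceChoiceDimTower.resolution_field_iff_berghRydh_field_of_choiceDim` — every reduced separated
  `k`-scheme of finite type; given the choices, resolution over `k` ⟺ Bergh–Rydh over `k`;
* `weightedThesis_of_hypersurfaceChoiceDim_of_forall_berghRydh_charP` (registered stub of the line,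
  RESHAPE 9) — **`(∀ p prime, ∀ e, Nonempty (HypersurfaceCentreChoiceDim p e))` and the characteristic-`p`
  instances of Bergh–Rydh give `WeightedThesis`**.
-/

noncomputable section

open CategoryTheory CategoryTheory.Limits AlgebraicGeometry TopologicalSpace
open Literature.AlgebraicGeometry.Resolution
open Summit.ResolutionOfSingularities.ResolutionOfSingularities.Theses.WeightedInvariant
open Summit.ResolutionOfSingularities.ResolutionOfSingularities.Theorems

set_option linter.dupNamespace false -- mandated namespace of this single-conjunct summit

/-! ## The tower inside one reachability class -/

namespace Summit.ResolutionOfSingularities.ResolutionOfSingularities.Theorems.HypersurfaceChoiceDimTower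

/-- **Every torus-quotient presentation of an integral hypersurface of `Y/k` REACHED IN TRANSVERSAL
DIMENSION `e` has a resolved quotient, granted a choice in transversal dimension `e` at `p = char k` and
Bergh–Rydh over `k`**: well-founded induction on the restricted tower-step relation
`ReachDim e P ∧ Step P' P` (property `(T)`), the motive guarded by `ReachDim e P`. Base (`X` regular):
quotient singularities (`DatumToEmbedded.quotientSingularities_of_regular`) and Bergh–Rydh. Step: the
guard releases `(iii)`, `(ii')`, `(H)` for the current pair; the datum-free tower lemmas give `B₊ → Y`,
the integral strict transform, the quotient step and the blow-up downstairs; the successor pair is a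
hypersurface pair, `Step`-below the current one (`Step.intro`) and again reached (`ReachDim.step`), so the
induction hypothesis resolves the new quotient, and the old one along the blow-up.
[cite: Wlodarczyk2022, Thm 1.1.4 (5), Thm 1.1.6; BerghRydh2019, Thm 5] -/
theorem hasResolution_quotient_of_gradedAtlas
    {p e : ℕ} (C : HypersurfaceCentreChoiceDim p e) {k : Type} [Field k] [CharP k p] [PerfectField k]
    (hBR : ∀ (V : Scheme.{0}) (g : V ⟶ Spec (.of k)) [IsIntegral V] [IsSeparated g]
      [LocallyOfFiniteType g] [QuasiCompact g],
      (∀ v : V, ∃ (A : Type) (_ : AddCommGroup A) (_ : Finite A) (_ : DecidableEq A)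
        (S : Type) (_ : CommRing S) (_ : Algebra k S) (𝒮 : A → Submodule k S)
        (_ : GradedAlgebra 𝒮), Algebra.FiniteType k S ∧ Algebra.Smooth k S ∧
        ∃ φ : Spec (.of (𝒮 0)) ⟶ V, Etale φ ∧ v ∈ Set.range φ ∧
          φ ≫ g = Spec.map (CommRingCat.ofHom (algebraMap k (𝒮 0)))) →
      Scheme.HasResolution V)
    (P : HypersurfacePair k) :
    HypersurfacePair.ReachDim (fun ⦃Y : Scheme.{0}⦄ (f : Y ⟶ Spec (.of k)) X => C.centre f X) e P →
    ∀ (X V : Scheme.{0}) (i : X ⟶ P.Y) [IsClosedImmersion i] [IsIntegral X], i.ker = P.X →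
      ∀ (g : V ⟶ Spec (.of k)) [IsSeparated g] [LocallyOfFiniteType g] [QuasiCompact g]
        [IsIntegral V] (q : X ⟶ V), q ≫ g = i ≫ P.f → ∀ (j : ℕ), GradedAtlas j P.f i q →
        Scheme.HasResolution V := by
  refine (C.wellFounded_step (k := k)).induction
    (C := fun P : HypersurfacePair k =>
      HypersurfacePair.ReachDim (fun ⦃Y : Scheme.{0}⦄ (f : Y ⟶ Spec (.of k)) X => C.centre f X) e P →
      ∀ (X V : Scheme.{0}) (i : X ⟶ P.Y) [IsClosedImmersion i] [IsIntegral X], i.ker = P.X →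
        ∀ (g : V ⟶ Spec (.of k)) [IsSeparated g] [LocallyOfFiniteType g] [QuasiCompact g]
          [IsIntegral V] (q : X ⟶ V), q ≫ g = i ≫ P.f → ∀ (j : ℕ), GradedAtlas j P.f i q →
          Scheme.HasResolution V) P ?_
  intro P ih hreach
  obtain ⟨Y, f, I, hI, hIi⟩ := P
  dsimp only
  intro X V i _ _ hIeq g _ _ _ _ q hq j 𝒜
  subst hIeq
  by_cases hreg : Scheme.IsRegular X
  · -- base: `X` regular ⇒ quotient singularities ⇒ Bergh–Rydh over `k`
    exact hBR V g (DatumToEmbedded.quotientSingularities_of_regular f i q g hq hreg 𝒜)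
  · -- step
    have hsing : ¬ Scheme.IsRegular i.ker.subscheme := fun h =>
      hreg ((isRegular_iff_isRegular_image i).mpr h)
    haveI : IsLocallyNoetherian Y := LocallyOfFiniteType.isLocallyNoetherian f
    have hY : Scheme.IsRegular Y := Scheme.IsRegular.of_smooth f (Scheme.isRegular_Spec (.of k))
    -- the current pair, reached in transversal dimension `e`
    let P : HypersurfacePair k :=
      @HypersurfacePair.mk k _ Y f inferInstance inferInstance inferInstance i.ker hI hIi
    have hreachP : HypersurfacePair.ReachDim
        (fun ⦃Y : Scheme.{0}⦄ (f : Y ⟶ Spec (.of k)) X => C.centre f X) e P := hreach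
    -- the guard releases `(iii)`, `(ii')`, `(H)`: a regular weighted centre off the generic point of `X`
    have hc : (C.centre f i.ker).IsRegularWeightedCentre :=
      C.isRegularWeightedCentre_centre P hreachP hsing
    have hξ : i (genericPoint X) ∉ (C.centre f i.ker).support :=
      C.genericPoint_not_mem_support_centre f i hI hreachP hreg
    -- the Rees filtration of the centre
    let R' : ReesFiltration Y :=
      { ideal := (C.centre f i.ker).piece
        ideal_zero := (C.centre f i.ker).piece_zero
        antitone := antitone_piece hc
        mul_le := (C.centre f i.ker).piece_mul_le }
    -- the new ambient is smooth separated quasi-compact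
    obtain ⟨hsm', hsep', hqc'⟩ :=
      WeightedThesis.GlobalCobordantPlus.smooth_πPlus_comp_of_isRegularWeightedCentre f
        (C.centre f i.ker) hc R' rfl
    haveI := hsm'; haveI := hsep'; haveI := hqc'
    -- the strict transform is integral and lies over `X`
    obtain ⟨hint', hker⟩ :=
      DatumToEmbedded.StrictTransform.isIntegral_strictTransformPlus_of_not_mem_support i
        (C.centre f i.ker) hc R' rfl hξ
    haveI := hint'
    set I' := R'.strictTransformPlus i.ker with hI'
    -- the successor pair is a hypersurface pair
    have hI'lp : IsLocallyPrincipal I' :=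
      WeightedThesis.HypersurfacePreserved.isLocallyPrincipal_strictTransformPlus hY
        (C.centre f i.ker) hc R' rfl i.ker hI
    have hI'i : IsIntegral I'.subscheme := hint'
    let i' := I'.subschemeι
    let σX : I'.subscheme ⟶ X := IsClosedImmersion.lift i (i' ≫ R'.πPlus) hker
    have hσX : σX ≫ i = i' ≫ R'.πPlus := IsClosedImmersion.lift_fac _ _ _
    -- `(H)`: homogeneity of the chosen centre on the charts of the presentation, then the quotient step
    have hhom := fun (a : 𝒜.ι) (n : ℕ) =>
      @HypersurfaceCentreChoiceDim.centre_isHomogeneous p e C k _ _ _ P hreachP hsing j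
        (𝒜.W a) (𝒜.piece a) (𝒜.gradedRing a) (𝒜.appLE_mem a) (𝒜.isHomogeneous_ker a) n
    obtain ⟨K, hK, hstep⟩ := DatumToEmbedded.quotientStep_of_isRegularWeightedCentre f i q g hq 𝒜
      (C.centre f i.ker) hc hξ hhom R' rfl σX hσX
    -- blow `V` up along `K`
    obtain ⟨V', ρ, hρ⟩ := exists_isBlowup V K
    haveI : IsLocallyNoetherian V := LocallyOfFiniteType.isLocallyNoetherian g
    haveI : IsProper ρ := hρ.isProper
    have hbir : IsBirational ρ := hρ.isBirational' hK
    haveI : IsIntegral V' := hρ.isIntegral hK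
    obtain ⟨q', hq', ⟨𝒜'⟩⟩ := hstep V' ρ hρ
    -- the successor pair is a step below the current one …
    let P' : HypersurfacePair k :=
      @HypersurfacePair.mk k _ R'.plus (R'.πPlus ≫ f) hsm' hsep' hqc' I' hI'lp hI'i
    have hlt : HypersurfacePair.Step (fun ⦃Y : Scheme.{0}⦄ (f : Y ⟶ Spec (.of k)) X => C.centre f X)
        P' P :=
      HypersurfacePair.Step.intro P hsing R' rfl hsm' hsep' hqc' hI'lp hI'i
    -- … and again reached in transversal dimension `e`: the induction hypothesis resolves `V'`
    have hreach' : HypersurfacePair.ReachDim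
        (fun ⦃Y : Scheme.{0}⦄ (f : Y ⟶ Spec (.of k)) X => C.centre f X) e P' := hreachP.step hlt
    have hV' : Scheme.HasResolution V' := by
      have hQ' := ih P' ⟨hreachP, hlt⟩ hreach'
      refine hQ' I'.subscheme V' i' (Scheme.IdealSheafData.ker_subschemeι I') (ρ ≫ g) q' ?_
        (j + 1) 𝒜'
      change q' ≫ ρ ≫ g = i' ≫ R'.πPlus ≫ f
      rw [← Category.assoc, hq', Category.assoc, hq, ← Category.assoc, hσX, Category.assoc]
    exact Scheme.HasResolution.of_isBirational ρ hbir hV'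

/-! ## Choices in every transversal dimension + Bergh–Rydh over `k` ⇒ resolution over `k` -/

/-- **Hypersurface centre choices in every transversal dimension (in characteristic `p`) and Bergh–Rydh
over the perfect field `k` of characteristic `p` resolve every integral HYPERSURFACE of every smooth
separated quasi-compact `k`-scheme**: start the tower in transversal dimension `e = dim V(ker i)`
(`ReachDim.start`) on the trivial presentation of rank `0` (`DatumToEmbedded.InitialAtlas.stub_initialAtlas`).
[cite: Wlodarczyk2022, Thm 1.1.6; BerghRydh2019, Thm 5] -/
theorem hasResolution_hypersurface_of_choiceDim_field
    {p : ℕ} (C : ∀ e : ℕ, HypersurfaceCentreChoiceDim p e) {k : Type} [Field k] [CharP k p]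
    [PerfectField k]
    (hBR : ∀ (V : Scheme.{0}) (g : V ⟶ Spec (.of k)) [IsIntegral V] [IsSeparated g]
      [LocallyOfFiniteType g] [QuasiCompact g],
      (∀ v : V, ∃ (A : Type) (_ : AddCommGroup A) (_ : Finite A) (_ : DecidableEq A)
        (S : Type) (_ : CommRing S) (_ : Algebra k S) (𝒮 : A → Submodule k S)
        (_ : GradedAlgebra 𝒮), Algebra.FiniteType k S ∧ Algebra.Smooth k S ∧
        ∃ φ : Spec (.of (𝒮 0)) ⟶ V, Etale φ ∧ v ∈ Set.range φ ∧
          φ ≫ g = Spec.map (CommRingCat.ofHom (algebraMap k (𝒮 0)))) →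
      Scheme.HasResolution V)
    {Y X : Scheme.{0}} (f : Y ⟶ Spec (.of k)) [Smooth f] [IsSeparated f] [QuasiCompact f]
    (i : X ⟶ Y) [IsClosedImmersion i] [IsIntegral X] (hX : IsLocallyPrincipal i.ker) :
    Scheme.HasResolution X := by
  obtain ⟨𝒜₀⟩ := DatumToEmbedded.InitialAtlas.stub_initialAtlas f i
  haveI : IsSeparated (i ≫ f) := inferInstance
  haveI : LocallyOfFiniteType (i ≫ f) := inferInstance
  haveI : QuasiCompact (i ≫ f) := inferInstance
  obtain ⟨e, he⟩ := hyp_exists_nat_topologicalKrullDim_ker_subscheme f i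
  exact hasResolution_quotient_of_gradedAtlas (C e) hBR (HypersurfacePair.ofKer f i hX)
    (HypersurfacePair.ReachDim.start he) X X i rfl (i ≫ f) (𝟙 X) (Category.id_comp _) 0 𝒜₀

/-- **Hypersurface centre choices in every transversal dimension and Bergh–Rydh over the perfect field `k`
of characteristic `p` resolve every reduced separated `k`-scheme of finite type**
(`hasResolution_hypersurface_of_choiceDim_field` spread by the line's hypersurface reduction
`HypersurfacesIff.hasResolution_of_hypersurfaces`). [cite: Wlodarczyk2022, Thm 1.1.6; BerghRydh2019, Thm 5;
Kollar2007, Prop. 2.48 (proof)] -/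
theorem hasResolution_of_choiceDim_field
    {p : ℕ} (hp : p.Prime) (C : ∀ e : ℕ, HypersurfaceCentreChoiceDim p e) {k : Type} [Field k]
    [CharP k p] [PerfectField k]
    (hBR : ∀ (V : Scheme.{0}) (g : V ⟶ Spec (.of k)) [IsIntegral V] [IsSeparated g]
      [LocallyOfFiniteType g] [QuasiCompact g],
      (∀ v : V, ∃ (A : Type) (_ : AddCommGroup A) (_ : Finite A) (_ : DecidableEq A)
        (S : Type) (_ : CommRing S) (_ : Algebra k S) (𝒮 : A → Submodule k S)
        (_ : GradedAlgebra 𝒮), Algebra.FiniteType k S ∧ Algebra.Smooth k S ∧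
        ∃ φ : Spec (.of (𝒮 0)) ⟶ V, Etale φ ∧ v ∈ Set.range φ ∧
          φ ≫ g = Spec.map (CommRingCat.ofHom (algebraMap k (𝒮 0)))) →
      Scheme.HasResolution V)
    (X : Scheme.{0}) (f : X ⟶ Spec (.of k)) [IsSeparated f] [LocallyOfFiniteType f]
    [QuasiCompact f] [IsReduced X] : Scheme.HasResolution X :=
  Summit.ResolutionOfSingularities.ResolutionOfSingularities.Theorems.WeightedThesis.HypersurfacesIff.hasResolution_of_hypersurfaces hp k
    (fun Y H g j hg hs hq hj hint hpr => by
      haveI := hg; haveI := hs; haveI := hq; haveI := hj; haveI := hint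
      exact hasResolution_hypersurface_of_choiceDim_field C hBR g j
        (isLocallyPrincipal_of_forall_isPrincipal hpr)) X f

/-- **The field-wise residue of the crux with choices in every transversal dimension.** Over a perfect
field `k` of characteristic `p` carrying hypersurface centre choices `C e : HypersurfaceCentreChoiceDim p e`
for every `e`, resolution of every reduced separated `k`-scheme of finite type is EQUIVALENT to
Bergh–Rydh's theorem over `k`. [cite: Wlodarczyk2022, Thm 1.1.6; BerghRydh2019, Thm 5] -/
theorem resolution_field_iff_berghRydh_field_of_choiceDim
    {p : ℕ} (hp : p.Prime) (C : ∀ e : ℕ, HypersurfaceCentreChoiceDim p e) (k : Type) [Field k]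
    [CharP k p] [PerfectField k] :
    (∀ (X : Scheme.{0}) (f : X ⟶ Spec (.of k)), IsSeparated f → LocallyOfFiniteType f →
      QuasiCompact f → IsReduced X → Scheme.HasResolution X) ↔
    ∀ (V : Scheme.{0}) (g : V ⟶ Spec (.of k)) [IsIntegral V] [IsSeparated g]
      [LocallyOfFiniteType g] [QuasiCompact g],
      (∀ v : V, ∃ (A : Type) (_ : AddCommGroup A) (_ : Finite A) (_ : DecidableEq A)
        (S : Type) (_ : CommRing S) (_ : Algebra k S) (𝒮 : A → Submodule k S)
        (_ : GradedAlgebra 𝒮), Algebra.FiniteType k S ∧ Algebra.Smooth k S ∧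
        ∃ φ : Spec (.of (𝒮 0)) ⟶ V, Etale φ ∧ v ∈ Set.range φ ∧
          φ ≫ g = Spec.map (CommRingCat.ofHom (algebraMap k (𝒮 0)))) →
      Scheme.HasResolution V :=
  ⟨Summit.ResolutionOfSingularities.ResolutionOfSingularities.Theorems.WeightedThesis.BerghRydhCharP.berghRydh_field_of_resolution_field,
    fun hBR X f hs hl hq hr => by
    haveI := hs; haveI := hl; haveI := hq; haveI := hr
    exact hasResolution_of_choiceDim_field hp C hBR X f⟩

end Summit.ResolutionOfSingularities.ResolutionOfSingularities.Theorems.HypersurfaceChoiceDimTower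

namespace Summit.ResolutionOfSingularities.ResolutionOfSingularities.Theorems

/-! ## The crux from choices in every transversal dimension and prime-wise Bergh–Rydh -/

/-- **`WeightedThesis` from hypersurface centre choices IN EVERY TRANSVERSAL DIMENSION and the
characteristic-`p` instances of Bergh–Rydh** (registered stub of line `datum-glued-split`, RESHAPE 9, crux
stmt-0569): if for every prime `p` and every `e : ℕ` a hypersurface centre choice in transversal dimension
`e` exists (`Nonempty (HypersurfaceCentreChoiceDim p e)`: the four obligations of a choice — regular weighted
centre, off the generic point, homogeneous on every torus chart of the pair, well-founded tower step —
demanded only on the pairs reached along the towers from a start hypersurface of dimension `e`; implied by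
the one-piece choice through `hyp_nonempty_choiceDim_of_hypersurfaceChoice`, hence by the strategy, the
hypersurface datum and `WeightedConstruction`), and for every prime `p` and every perfect field `k` of
characteristic `p` every integral separated finite-type `k`-scheme with finite diagonalizable quotient
singularities étale-locally has a resolution, then every reduced separated scheme of finite type over every
perfect field of positive characteristic has a resolution.
[cite: Wlodarczyk2022, Thm 1.1.6; BerghRydh2019, Thm 5; AbramovichTemkinWlodarczyk2024, §1.9] -/
theorem weightedThesis_of_hypersurfaceChoiceDim_of_forall_berghRydh_charP : (∀ p : ℕ, p.Prime → ∀ e : ℕ, Nonempty (Summit.ResolutionOfSingularities.ResolutionOfSingularities.Theorems.HypersurfaceCentreChoiceDim p e)) → (∀ p : ℕ, p.Prime → ∀ (k : Type) [Field k] [CharP k p] [PerfectField k] (V : AlgebraicGeometry.Scheme.{0}) (g : V ⟶ AlgebraicGeometry.Spec (.of k)) [AlgebraicGeometry.IsIntegral V] [AlgebraicGeometry.IsSeparated g] [AlgebraicGeometry.LocallyOfFiniteType g] [AlgebraicGeometry.QuasiCompact g], (∀ v : V, ∃ (A : Type) (_ : AddCommGroup A) (_ : Finite A) (_ : DecidableEq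 A) (S : Type) (_ : CommRing S) (_ : Algebra k S) (𝒮 : A → Submodule k S) (_ : GradedAlgebra 𝒮), Algebra.FiniteType k S ∧ Algebra.Smooth k S ∧ ∃ φ : AlgebraicGeometry.Spec (.of (𝒮 0)) ⟶ V, AlgebraicGeometry.Etale φ ∧ v ∈ Set.range φ ∧ φ ≫ g = AlgebraicGeometry.Spec.map (CommRingCat.ofHom (algebraMap k (𝒮 0)))) → Literature.AlgebraicGeometry.Resolution.Scheme.HasResolution V) → Summit.ResolutionOfSingularities.ResolutionOfSingularities.Theses.WeightedInvariant.WeightedThesis := by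
  intro hC hBR p hp k _ _ _ X f hs hl hq hr
  have C : ∀ e : ℕ, HypersurfaceCentreChoiceDim p e := fun e => Classical.choice (hC p hp e)
  haveI := hs; haveI := hl; haveI := hq; haveI := hr
  exact HypersurfaceChoiceDimTower.hasResolution_of_choiceDim_field hp C
    (fun V g _ _ _ _ hV => hBR p hp k V g hV) X f

/-- **The one-piece door through the ladder**: choices at every prime (and a fortiori strategies, hypersurface
data, `WeightedConstruction`) and prime-wise Bergh–Rydh give `WeightedThesis`, factored through the choices
in every transversal dimension. [folklore] -/
theorem weightedThesis_of_hypersurfaceChoice_of_forall_berghRydh_charP' :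
    (∀ p : ℕ, p.Prime → Nonempty (HypersurfaceCentreChoice p)) →
    (∀ p : ℕ, p.Prime → ∀ (k : Type) [Field k] [CharP k p] [PerfectField k] (V : Scheme.{0})
      (g : V ⟶ Spec (.of k)) [IsIntegral V] [IsSeparated g] [LocallyOfFiniteType g] [QuasiCompact g],
      (∀ v : V, ∃ (A : Type) (_ : AddCommGroup A) (_ : Finite A) (_ : DecidableEq A)
        (S : Type) (_ : CommRing S) (_ : Algebra k S) (𝒮 : A → Submodule k S)
        (_ : GradedAlgebra 𝒮), Algebra.FiniteType k S ∧ Algebra.Smooth k S ∧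
        ∃ φ : Spec (.of (𝒮 0)) ⟶ V, Etale φ ∧ v ∈ Set.range φ ∧
          φ ≫ g = Spec.map (CommRingCat.ofHom (algebraMap k (𝒮 0)))) →
      Scheme.HasResolution V) →
    WeightedThesis :=
  fun hC => weightedThesis_of_hypersurfaceChoiceDim_of_forall_berghRydh_charP
    fun p hp e => HypersurfaceCentreChoiceDim.nonempty_of_nonempty_choice (hC p hp) e

end Summit.ResolutionOfSingularities.ResolutionOfSingularities.Theorems

end
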